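import Literature.NumberTheory.EllipticCurves.LocalPointsPlaceTransportProofs
import Literature.NumberTheory.EllipticCurves.SelmerLocalRestrictionKernel
import Literature.NumberTheory.EllipticCurves.TateParameterPrimeTorsion
import HarnessLib

/-!
# `#Sel⁽ᵖ⁾(E/ℚ) ≤ p · #Z_p(E)` from `E(ℚ_p)[p] = 0` in `ℚ_[p]`-currency, and the Tate-parameter test

Topic `NumberTheory/EllipticCurves`. Theorems only: **no definition and no named fact is introduced**
(D-0014 / D-0026). One-line compositions of three tree files:

* `LocalPointsPlaceTransportProofs.lean` — `E(ℚ_v)[n] ≅ E(ℚ_p)[n]` at the place `v ∋ p` of `ℚ`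
  (`WeierstrassCurve.natCard_ker_nsmul_adicCompletion_eq_one_of_forall_padic` etc.);
* `SelmerLocalRestrictionKernel.lean` — `#E(ℚ_v)[p] = 1 ⟹ #Sel⁽ᵖ⁾(E/ℚ) ≤ p · #Z_v(E)`
  (`WeierstrassCurve.natCard_selmerGroup_le_prime_mul_of_natCard_torsion_eq_one`; Bhargava–Skinner,
  J. Ramanujan Math. Soc. 29 (2014), Thm. 7 (ii) and the proof of Lemma 16), `Z_v = W.selmerResKer p ℚ_v`;
* `TateParameterPrimeTorsion.lean` — at a split multiplicative odd `p` with Tate parameter `q_E`,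
  `E(ℚ_p)[p] = 0 ⟺ q_E ∉ (ℚ_p)^p` (below the registered named fact `tateUniformization_points`,
  Silverman *ATAEC* Thm. V.3.1 (d) / V.5.3, taken as the hypothesis `hT`; `μ_p(ℚ_p) = 1`, Serre II §3.2).

## What is proved

* `WeierstrassCurve.natCard_selmerGroup_le_prime_mul_of_forall_padic` — **`(∀ P ∈ E(ℚ_p), pP = O →
  P = O) ⟹ #Sel⁽ᵖ⁾(E/ℚ) ≤ p · #Z_v(E)`**; in the `(A, B)`-currency of the height family
  `natCard_selmerGroup_shortWeierstrass_le_mul_of_forall_padic` (the binder `hker` of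
  `bsz_rankLeOne_cRank_of_pieces` per curve, its local input in `ℚ_[p]`-currency — ready for the summit
  cone's `X11b.LocalTorsion.localTorsion_eq_zero_of_mult`, non-split / `p ∤ v_p(Δ_min)`, `p ≥ 3`).
* `WeierstrassCurve.torsionBy_eq_bot_of_forall_padic` — `(∀ P ∈ E(ℚ_p), pP = O → P = O) ⟹ E(ℚ)[p] = 0`.
* `natCard_ker_nsmul_adicCompletion_eq_one_iff_not_exists_pow_eq_tateParameter` —
  **`#E(ℚ_v)[p] = 1 ⟺ q_E ∉ (ℚ_p)^p`** (split multiplicative odd `p`, below `hT`);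
  `natCard_selmerGroup_le_prime_mul_of_not_exists_pow_eq_tateParameter` —
  **`q_E ∉ (ℚ_p)^p ⟹ #Sel⁽ᵖ⁾(E/ℚ) ≤ p · #Z_v(E)`**;
  `torsionBy_eq_bot_of_not_exists_pow_eq_tateParameter` — `q_E ∉ (ℚ_p)^p ⟹ E(ℚ)[p] = 0`.

For the BSD-DENSITY SPRINT of cell `b2b-bsdres` (book `cells/density/CONVERSION-QUEUE.md`, rows Q4
`hker` / Q4′): on the slice `P = SP′` of the res-cell assembly the binder `hker` holds below the one
local input `E(ℚ₅)[5] = 0`, whose three printed sources — non-split / `5 ∤ v₅(Δ)` (summit cone,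
`ℚ_[5]`-currency), split with `q_E ∉ (ℚ₅)^5` (the Tate test: the complement of the Tate-power set
`T₅`), good reduction (the instantiation of `P`) — now each discharge `hker` in one line.

## References

* [BhargavaSkinner2014] M. Bhargava, C. Skinner, J. Ramanujan Math. Soc. 29 (2014) = arXiv:1401.0233,
  Thm. 7 (ii), proof of Lemma 16 (chunk p0012 L106–130).
* [SilvermanATAEC1994] J. H. Silverman, *Advanced Topics*, GTM 151 (1994), Thm. V.3.1 (d), V.5.3.
* [SilvermanAEC2009] J. H. Silverman, *The Arithmetic of Elliptic Curves*, 2nd ed. (2009), VII.§3.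
* [Serre1973] J.-P. Serre, *A Course in Arithmetic*, Ch. II §3.2 Thm. 2.
* [SkinnerZhang2014] C. Skinner, W. Zhang, arXiv:1407.1099v1, Thm. 1.1 (b).
-/

noncomputable section

open scoped Classical

namespace WeierstrassCurve

section Padic

open Rat.HeightOneSpectrum NumberField IsDedekindDomain

variable (W : WeierstrassCurve ℚ) {p : ℕ} [hp : Fact p.Prime] {v : HeightOneSpectrum (𝓞 ℚ)}

/-- **`E(ℚ_p)[p] = 0 ⟹ #Sel⁽ᵖ⁾(E/ℚ) ≤ p · #Z_v(E)`** for an elliptic curve `E/ℚ`, a prime `p`, the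
place `v ∋ p`, and `Z_v(E) = W.selmerResKer p ℚ_v` (the `p`-Selmer classes with trivial restriction at
`p`): `natCard_selmerGroup_le_prime_mul_of_natCard_torsion_eq_one` with its local input supplied in
`ℚ_[p]`-currency (`natCard_ker_nsmul_adicCompletion_eq_one_of_forall_padic`). The shape per curve of
the binder `hker` of `bsz_rankLeOne_cRank_of_pieces` (`p = 5`), ready for the summit cone's
`localTorsion_eq_zero_of_mult` (non-split / `p ∤ v_p(Δ_min)`) and for the Tate test below.
[cite: BhargavaSkinner2014, Thm 7 (ii) and proof of Lemma 16] -/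
theorem natCard_selmerGroup_le_prime_mul_of_forall_padic [W.IsElliptic]
    (hpv : (p : 𝓞 ℚ) ∈ v.asIdeal)
    (h : ∀ P : (W.baseChange ℚ_[p]).toAffine.Point, p • P = 0 → P = 0) :
    Nat.card (W.selmerGroup p) ≤ p * Nat.card (W.selmerResKer (p : ℤ) (v.adicCompletion ℚ)) :=
  W.natCard_selmerGroup_le_prime_mul_of_natCard_torsion_eq_one hpv
    (W.natCard_ker_nsmul_adicCompletion_eq_one_of_forall_padic hpv h)

/-- **`E(ℚ_p)[p] = 0 ⟹ E(ℚ)[p] = 0`** with the local input in `ℚ_[p]`-currency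
(`E(ℚ)[p] ⊆ E(ℚ_p)[p]`, Silverman VII.§3; `torsionBy_eq_bot_of_natCard_ker_nsmul_baseChange_eq_one`
with `L = ℚ_[p]`): the global hypothesis `t_p(E) = 0` of the parity and `(cork1)` steps from the
same local input. [cite: SilvermanAEC2009, VII.§3 (proof of Prop. VII.3.1)] -/
theorem torsionBy_eq_bot_of_forall_padic
    (h : ∀ P : (W.baseChange ℚ_[p]).toAffine.Point, p • P = 0 → P = 0) :
    AddSubgroup.torsionBy W.toAffine.Point (p : ℤ) = ⊥ := by
  -- The proof of `torsionBy_eq_bot_of_natCard_ker_nsmul_baseChange_eq_one` (sibling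
  -- `SelmerLocalRestrictionKernel`), re-run over `ℚ`: that lemma is stated for a general field under
  -- the classical `DecidableEq`, whereas `E(ℚ)`'s group law here carries `instDecidableEqRat`.
  let ι : W.toAffine.Point →+ (W.baseChange ℚ_[p]).toAffine.Point :=
    Affine.Point.baseChange (W' := W) ℚ ℚ_[p]
  have hinj : Function.Injective ι := Affine.Point.map_injective (W' := W) _
  refine (AddSubgroup.eq_bot_iff_forall _).2 fun P hP => hinj ?_
  rw [map_zero]
  have hP' : (p : ℤ) • P = 0 := by
    simpa only [AddSubgroup.torsionBy, Submodule.mem_toAddSubgroup, Submodule.mem_torsionBy_iff]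
      using hP
  refine h (ι P) ?_
  rw [← map_nsmul, ← natCast_zsmul, hP', map_zero]

end Padic

end WeierstrassCurve

/-! ## Split multiplicative odd `p`: the Tate-parameter test in `ℚ_v`-currency -/

namespace Literature.NumberTheory.EllipticCurves

open _root_.WeierstrassCurve _root_.NumberField _root_.IsDedekindDomain

section Tate

variable {p : ℕ} [hp : Fact p.Prime] (W : WeierstrassCurve ℚ) [W.IsElliptic]
  {v : HeightOneSpectrum (𝓞 ℚ)}

/-- **`#E(ℚ_v)[p] = 1 ⟺ q_E ∉ (ℚ_p)^p` at a split multiplicative odd `p`** (`v ∋ p` the place of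
`ℚ`, `D` a Tate parameter datum of `E` at `p`, `q_E = D.q`): the Tate test
`natCard_ker_nsmul_eq_one_iff_not_exists_pow_eq_tateParameter` (`E(ℚ_p) ≅ ℚ_p^×/q_E^ℤ`,
`μ_p(ℚ_p) = 1`) moved to the completion `ℚ_v` of the Selmer files
(`natCard_ker_nsmul_adicCompletion_eq_padic`). CONDITIONAL on `hT : tateUniformization_points` only.
[cite: SilvermanATAEC1994, Thm. V.3.1 (d) and Thm. V.5.3] [cite: Serre1973, Ch. II §3.2 Thm. 2] -/
theorem natCard_ker_nsmul_adicCompletion_eq_one_iff_not_exists_pow_eq_tateParameter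
    (hT : tateUniformization_points) (hp2 : p ≠ 2) (D : WeierstrassCurve.TateParameterData W p)
    (hpv : (p : 𝓞 ℚ) ∈ v.asIdeal) :
    Nat.card (nsmulAddMonoidHom p :
        (W.baseChange (v.adicCompletion ℚ)).toAffine.Point →+ _).ker = 1 ↔
      ¬ ∃ u : ℚ_[p], u ^ p = D.q := by
  rw [W.natCard_ker_nsmul_adicCompletion_eq_padic hpv p]
  exact natCard_ker_nsmul_eq_one_iff_not_exists_pow_eq_tateParameter W hT hp2 D

/-- **`q_E ∉ (ℚ_p)^p ⟹ #Sel⁽ᵖ⁾(E/ℚ) ≤ p · #Z_v(E)` at a split multiplicative odd `p`**: the binder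
`hker` of `bsz_rankLeOne_cRank_of_pieces` per curve on the split-multiplicative part of the slice
`SP′` (outside the Tate-power set `T_p`), below `hT : tateUniformization_points`.
[cite: BhargavaSkinner2014, Thm 7 (ii) and proof of Lemma 16]
[cite: SilvermanATAEC1994, Thm. V.3.1 (d) and Thm. V.5.3] -/
theorem natCard_selmerGroup_le_prime_mul_of_not_exists_pow_eq_tateParameter
    (hT : tateUniformization_points) (hp2 : p ≠ 2) (D : WeierstrassCurve.TateParameterData W p)
    (hpv : (p : 𝓞 ℚ) ∈ v.asIdeal) (hq : ¬ ∃ u : ℚ_[p], u ^ p = D.q) :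
    Nat.card (W.selmerGroup p) ≤ p * Nat.card (W.selmerResKer (p : ℤ) (v.adicCompletion ℚ)) :=
  W.natCard_selmerGroup_le_prime_mul_of_forall_padic hpv
    ((forall_prime_smul_eq_zero_iff_not_exists_pow_eq_tateParameter W hT hp2 D).mpr hq)

/-- **`q_E ∉ (ℚ_p)^p ⟹ E(ℚ)[p] = 0` at a split multiplicative odd `p`** (`E(ℚ)[p] ⊆ E(ℚ_p)[p] = 0`):
the global `p`-torsion hypothesis of the parity / `(cork1)` steps on the same slice, below `hT`.
[cite: SilvermanATAEC1994, Thm. V.3.1 (d) and Thm. V.5.3]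
[cite: SilvermanAEC2009, VII.§3 (proof of Prop. VII.3.1)] -/
theorem torsionBy_eq_bot_of_not_exists_pow_eq_tateParameter
    (hT : tateUniformization_points) (hp2 : p ≠ 2) (D : WeierstrassCurve.TateParameterData W p)
    (hq : ¬ ∃ u : ℚ_[p], u ^ p = D.q) :
    AddSubgroup.torsionBy W.toAffine.Point (p : ℤ) = ⊥ :=
  W.torsionBy_eq_bot_of_forall_padic
    ((forall_prime_smul_eq_zero_iff_not_exists_pow_eq_tateParameter W hT hp2 D).mpr hq)

end Tate

/-! ## The `(A, B)`-currency of the height family -/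

/-- **The binder `hker` per curve with its local input in `ℚ_[p]`-currency**: for `E_{A,B}` in the
height family, a prime `p`, the place `v ∋ p` of `ℚ`, and `Z(E_{A,B}) := Z_v(E_{A,B})`
(`selmerResKer`), if `E_{A,B}(ℚ_p)[p] = 0` (`∀ P ∈ E_{A,B}(ℚ_[p]), pP = O → P = O`) then
`#Sel_p(E_{A,B}) ≤ p · #Z(E_{A,B})` — at `p = 5` the conclusion of the binder `hker` of
`bsz_rankLeOne_cRank_of_pieces` for this `Z`. [cite: BhargavaSkinner2014, Thm 7 (ii) and proof of Lemma 16] -/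
theorem natCard_selmerGroup_shortWeierstrass_le_mul_of_forall_padic {AB : ℤ × ℤ}
    (hAB : IsInHeightFamily AB) {p : ℕ} [Fact p.Prime] {v : HeightOneSpectrum (𝓞 ℚ)}
    (hpv : (p : 𝓞 ℚ) ∈ v.asIdeal)
    (h : ∀ P : ((shortWeierstrass AB).baseChange ℚ_[p]).toAffine.Point, p • P = 0 → P = 0) :
    Nat.card ((shortWeierstrass AB).selmerGroup p) ≤
      p * Nat.card ((shortWeierstrass AB).selmerResKer (p : ℤ) (v.adicCompletion ℚ)) := by
  haveI := isElliptic_shortWeierstrass hAB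
  exact (shortWeierstrass AB).natCard_selmerGroup_le_prime_mul_of_forall_padic hpv h

end Literature.NumberTheory.EllipticCurves

end
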